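import Literature.AlgebraicGeometry.HodgeTheory.AbelianVarietyHomTorsionScalarRigidity
import HarnessLib

/-!
# A homomorphism killing a cofinal torsion tower is zero; ONE-SIDED rigidity of homomorphisms
# agreeing on division points up to a unit scalar (Lange 2023, §1.1.2 Prop. 1.1.14, §2.4.1)

Topic `AlgebraicGeometry/HodgeTheory`; namespace `Literature.AlgebraicGeometry.HodgeTheory.AbelianVariety`.
KERNEL ONLY: theorems; no definition, no named fact, no instance, no `sorry`.  Sequel of
`AbelianVarietyHomTorsionScalarRigidity` (two-sided quasi-inverse).

* `eq_zero_of_forall_torsionPoints_map_eq_one`: a homomorphism `φ : A → B` of complex abelian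
  varieties with `φ(A[M](ℂ)) = 1` for every `M ≠ 0` of a cofinal tower `N ∣ M` is `0` — the
  division points are dense ([Lange 2023] Prop. 1.1.14 `A[n] ≅ (ℤ/n)^{2g}`, [Mumford] §19); here via
  the naturality of the monodromy isomorphism `H₁(A(ℂ); ℤ)/M ≅ A[M](ℂ)` (the tree's
  `coe_modNHOneEquivTorsionPoints_mkQ_map`): `φ_* H₁(A) ⊆ M · H₁(B)` for unboundedly many `M`, so
  `φ_* = 0` on `H₁(B(ℂ); ℤ) ≅ ℤ^{2 dim B}`, and `ρ_r` is faithful.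
* `eq_or_eq_neg_of_forall_torsionPoints_map_eq_pow_of_comp_eq`: the rigidity theorem with `lam₁`
  only required to have a LEFT quasi-inverse `ψ` (`lam₁ ≫ ψ = n · 1_A`) — e.g. a homomorphism with
  finite kernel into a possibly larger abelian variety.  Reduction to the two-sided theorem
  (★ `eq_or_eq_neg_of_forall_torsionPoints_map_eq_pow`) for the pair `(n · 1_A, lam₂ ≫ ψ)` of
  ENDOMORPHISMS of `A` (`n · 1_A` is its own two-sided partner): `lam₂ ≫ ψ = ± n · 1_A`; then
  `n · (lam₂ ∓ lam₁)` kills every `A[M](ℂ)` of the tower (`P^{n a_M} = ψ(lam₂ P) = P^{±n}`), hence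
  vanishes, and `Hom(A, B)` is torsion-free (★ `eq_zero_of_zsmul_eq_zero`).

Use (cell `hodgecm-mathlib`, W3c (c-iii)): the polarisation `λ̄′` of the fibre is known to have
FINITE kernel (`HasType`) but the carrier does not record `dim Â = dim A`, so only a left
quasi-inverse is available to the λ-clause.

## References
* [Lange2023AbelianVarietiesComplex] H. Lange, *Abelian Varieties over the Complex Numbers* (2023),
  §1.1.2 Prop. 1.1.14 (PDF p. 22), §1.1.3 (PDF p. 23), §2.4.1 Cor. 2.4.11 (PDF p. 117).
* [MumfordAV1970] D. Mumford, *Abelian Varieties* (1970), §19 (Thm. 3 and proof), §4.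
* [Milne1986AbelianVarieties] J. S. Milne, *Abelian Varieties* (1986), Prop. 17.5 (b).
-/

noncomputable section

open Module CategoryTheory Function
open Literature.AlgebraicTopology.SingularHomology
open Literature.AlgebraicTopology.FundamentalGroup

universe u

namespace Literature.AlgebraicGeometry.HodgeTheory

namespace AbelianVariety

open _root_.AlgebraicGeometry
open Literature.AlgebraicGeometry.Motives
open Literature.AlgebraicGeometry.Motives.AbelianVariety
open scoped MonObj

variable {A B : Motives.AbelianVariety ℂ}

/-! ## §1 Points algebra (private copies) -/

/-- `(u + v)(P) = u(P) · v(P)` on complex points. [cite: MumfordAV1970, §19 (first paragraph)] -/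
private theorem map_hom_add' (u v : A ⟶ B) (P : A.Points ℂ) :
    AlgPoints.map (u + v).hom.hom.hom P = AlgPoints.map u.hom.hom.hom P * AlgPoints.map v.hom.hom.hom P := by
  rw [AlgPoints.map_apply, hom_add, Grp.Hom.hom_mul, Mon.Hom.hom_mul, MonObj.comp_mul]
  rfl

/-- `(u - v)(P) = u(P) · v(P)⁻¹` on complex points. [cite: MumfordAV1970, §19 (first paragraph)] -/
private theorem map_hom_sub' (u v : A ⟶ B) (P : A.Points ℂ) :
    AlgPoints.map (u - v).hom.hom.hom P = AlgPoints.map u.hom.hom.hom P * (AlgPoints.map v.hom.hom.hom P)⁻¹ := by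
  rw [eq_mul_inv_iff_mul_eq, ← map_hom_add', sub_add_cancel]

/-- `(f ≫ g)(P) = g(f(P))` on complex points. [folklore] -/
private theorem map_hom_comp' {C : Motives.AbelianVariety ℂ} (f : A ⟶ B) (g : B ⟶ C) (P : A.Points ℂ) :
    AlgPoints.map (f ≫ g).hom.hom.hom P = AlgPoints.map g.hom.hom.hom (AlgPoints.map f.hom.hom.hom P) :=
  (Category.assoc _ _ _).symm

/-- `u(1) = 1` on complex points. [cite: MumfordAV1970, §4] -/
private theorem map_hom_one' (u : A ⟶ B) : AlgPoints.map u.hom.hom.hom (1 : A.Points ℂ) = 1 := by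
  have h := (IsMonHom.monoidHom u.hom.hom.hom (specOver ℂ ℂ)).map_one
  rwa [IsMonHom.monoidHom_apply, ← AlgPoints.map_apply] at h

/-! ## §2 A homomorphism killing a cofinal torsion tower is zero -/

/-- **A homomorphism `φ : A → B` of complex abelian varieties which kills `A[M](ℂ)` for every `M ≠ 0`
of a cofinal tower `N ∣ M` is zero** (density of the division points, [Lange 2023] Prop. 1.1.14 /
[Mumford] §19; via the monodromy isomorphism `H₁/M ≅ A[M](ℂ)`, natural in `φ`:
`φ_* H₁(A(ℂ); ℤ) ⊆ M · H₁(B(ℂ); ℤ)` for unboundedly many `M`, so `φ_* = 0`, and `ρ_r` is faithful).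
[cite: Lange2023AbelianVarietiesComplex, §1.1.2 Prop. 1.1.14 (PDF p. 22) and §1.1.3 (PDF p. 23)] [cite: MumfordAV1970, §19 (Thm. 3 and its proof)] -/
theorem eq_zero_of_forall_torsionPoints_map_eq_one (φ : A ⟶ B) {N : ℕ} (hN : N ≠ 0)
    (h : ∀ M : ℕ, N ∣ M → M ≠ 0 → ∀ P ∈ A.torsionPoints ℂ M, AlgPoints.map φ.hom.hom.hom P = 1) :
    φ = 0 := by
  classical
  obtain ⟨eB⟩ := nonempty_singularHomology_one_addEquiv_pi B
  apply hom_eq_of_singularHomology_map_one_eq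
  intro c
  rw [singularHomology_int_map_zero_one, ModuleCat.hom_zero, LinearMap.zero_apply]
  set v := (singularHomology.map ℤ ℤ (AlgPoints.mapContinuous (L := ℂ) φ.hom.hom.hom) 1).hom c with hv
  -- `φ_* c ∈ M · H₁(B)` for every level `M` of the tower
  have hdiv : ∀ M : ℕ, N ∣ M → M ≠ 0 → ∃ y : singularHomology ℤ ℤ (B.Points ℂ) 1, M • y = v := by
    intro M hNM hM0
    apply (modN_mkQ_eq_zero_iff M v).1
    apply (modNHOneEquivTorsionPoints B M hM0).injective
    apply Additive.toMul.injective
    apply Subtype.ext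
    rw [hv, coe_modNHOneEquivTorsionPoints_mkQ_map φ M hM0 c, map_zero, IsMonHom.monoidHom_apply,
      ← AlgPoints.map_apply, h M hNM hM0 _ (Subtype.coe_prop _)]
    rfl
  -- read in `ℤ^{2 dim B}`: every coordinate of `eB v` is divisible by `N m` for all `m ≥ 1`, hence `0`
  apply eB.injective
  rw [map_zero]
  funext i
  rw [Pi.zero_apply]
  have hdvd : ∀ m : ℕ, m ≠ 0 → ((N * m : ℕ) : ℤ) ∣ eB v i := fun m hm => by
    obtain ⟨y, hy⟩ := hdiv (N * m) (Dvd.intro m rfl) (mul_ne_zero hN hm)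
    refine ⟨eB y i, ?_⟩
    rw [← hy, map_nsmul, Pi.smul_apply, nsmul_eq_mul]
  set z := eB v i with hz
  obtain ⟨t, ht⟩ := hdvd (z.natAbs + 1) (Nat.succ_ne_zero _)
  rcases eq_or_ne t 0 with rfl | ht0
  · simpa using ht
  · exfalso
    have h1 : ((N * (z.natAbs + 1) : ℕ) : ℤ) ≤ |z| := by
      calc ((N * (z.natAbs + 1) : ℕ) : ℤ) = |((N * (z.natAbs + 1) : ℕ) : ℤ)| :=
            (abs_of_nonneg (by positivity)).symm
        _ ≤ |((N * (z.natAbs + 1) : ℕ) : ℤ)| * |t| :=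
            le_mul_of_one_le_right (abs_nonneg _) (Int.one_le_abs ht0)
        _ = |z| := by rw [← abs_mul, ← ht]
    have h2 : |z| = (z.natAbs : ℤ) := Int.abs_eq_natAbs z
    have h4 : ((z.natAbs + 1 : ℕ) : ℤ) ≤ ((N * (z.natAbs + 1) : ℕ) : ℤ) := by
      exact_mod_cast Nat.le_mul_of_pos_left _ (Nat.pos_of_ne_zero hN)
    push_cast at h1 h4
    omega

/-! ## §3 One-sided rigidity -/

/-- **ONE-SIDED rigidity.**  Homomorphisms `lam₁, lam₂ : A → B` of complex abelian varieties, `lam₁`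
with a LEFT quasi-inverse `ψ` (`lam₁ ≫ ψ = n · 1_A`, `n ≠ 0`), agreeing on `A[M](ℂ)` up to a unit
scalar `a_M` for every `M ≠ 0` of a cofinal tower `N ∣ M`, satisfy `lam₂ = lam₁ ∨ lam₂ = -lam₁`:
the two-sided theorem applied to the endomorphisms `(n · 1_A, lam₂ ≫ ψ)` gives
`lam₂ ≫ ψ = ± n · 1_A`, so `P^{n a_M} = ψ(lam₂(P)) = P^{±n}` on `A[M](ℂ)` and `n · (lam₂ ∓ lam₁)` kills
the tower, hence vanishes; `Hom(A, B)` is torsion-free.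
[cite: Lange2023AbelianVarietiesComplex, §2.4.1 proof of Cor. 2.4.11 (PDF p. 117); §1.1.2–§1.1.3 (PDF pp. 19–23)]
[cite: Milne1986AbelianVarieties, Prop. 17.5 (b)] -/
theorem eq_or_eq_neg_of_forall_torsionPoints_map_eq_pow_of_comp_eq (lam₁ lam₂ : A ⟶ B)
    (hψ : ∃ (ψ : B ⟶ A) (n : ℕ), n ≠ 0 ∧ lam₁ ≫ ψ = (n : ℤ) • 𝟙 A)
    {N : ℕ} (hN : N ≠ 0)
    (h : ∀ M : ℕ, N ∣ M → M ≠ 0 → ∃ a : ℤ, IsCoprime a (M : ℤ) ∧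
      ∀ P ∈ A.torsionPoints ℂ M, AlgPoints.map lam₂.hom.hom.hom P = AlgPoints.map lam₁.hom.hom.hom P ^ a) :
    lam₂ = lam₁ ∨ lam₂ = -lam₁ := by
  classical
  obtain ⟨ψ, n, hn, hψ₁⟩ := hψ
  -- the endomorphisms `n · 1_A` and `β = lam₂ ≫ ψ` agree on the tower up to the same units
  have hβ : ∀ M : ℕ, N ∣ M → M ≠ 0 → ∃ a : ℤ, IsCoprime a (M : ℤ) ∧
      ∀ P ∈ A.torsionPoints ℂ M, AlgPoints.map (lam₂ ≫ ψ).hom.hom.hom P =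
        AlgPoints.map ((n : ℤ) • 𝟙 A :).hom.hom.hom P ^ a := by
    intro M hNM hM0
    obtain ⟨a, ha, hP⟩ := h M hNM hM0
    refine ⟨a, ha, fun P hPM => ?_⟩
    rw [map_hom_comp', hP P hPM, map_hom_zpow, ← map_hom_comp', hψ₁]
  have h2 := eq_or_eq_neg_of_forall_torsionPoints_map_eq_pow ((n : ℤ) • 𝟙 A) (lam₂ ≫ ψ)
    ⟨𝟙 A, n, hn, by rw [Category.comp_id], by rw [Category.id_comp]⟩ hN hβ
  -- `n · (lam₂ - ε lam₁)` kills the tower, for the sign `ε` with `lam₂ ≫ ψ = ε n`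
  have key : ∀ ε : ℤ, lam₂ ≫ ψ = ε • ((n : ℤ) • 𝟙 A) → (n : ℤ) • (lam₂ - ε • lam₁) = 0 := by
    intro ε hε
    apply eq_zero_of_forall_torsionPoints_map_eq_one _ hN
    intro M hNM hM0 P hPM
    obtain ⟨a, -, hP⟩ := h M hNM hM0
    -- `ψ(lam₂ P) = P^{n a}` and `= P^{ε n}`
    have hβP : AlgPoints.map lam₁.hom.hom.hom P ^ ((n : ℤ) * a) =
        AlgPoints.map lam₁.hom.hom.hom P ^ (ε * (n : ℤ)) := by
      have e1 : AlgPoints.map (lam₂ ≫ ψ).hom.hom.hom P = P ^ ((n : ℤ) * a) := by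
        rw [map_hom_comp', hP P hPM, map_hom_zpow, ← map_hom_comp', hψ₁, map_zsmul_id_hom, ← zpow_mul]
      have e2 : AlgPoints.map (lam₂ ≫ ψ).hom.hom.hom P = P ^ (ε * (n : ℤ)) := by
        rw [hε, map_zsmul_hom, map_zsmul_id_hom, ← zpow_mul, mul_comm]
      have e3 : P ^ ((n : ℤ) * a) = P ^ (ε * (n : ℤ)) := e1.symm.trans e2
      rw [← map_hom_zpow, ← map_hom_zpow, e3]
    rw [map_zsmul_hom, map_hom_sub', map_zsmul_hom, hP P hPM, ← zpow_neg, ← zpow_add, ← zpow_mul]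
    have : (a + -ε) * (n : ℤ) = (n : ℤ) * a - ε * (n : ℤ) := by ring
    rw [this, zpow_sub, hβP, mul_inv_cancel]
  rcases h2 with hc | hc
  · left
    have h0 := key 1 (by rw [hc, one_smul])
    rw [one_smul] at h0
    exact sub_eq_zero.mp (eq_zero_of_zsmul_eq_zero (Int.natCast_ne_zero.mpr hn) h0)
  · right
    have h0 := key (-1) (by rw [hc, neg_one_smul])
    rw [neg_one_smul, sub_neg_eq_add] at h0
    exact eq_neg_of_add_eq_zero_left (eq_zero_of_zsmul_eq_zero (Int.natCast_ne_zero.mpr hn) h0)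

end AbelianVariety

end Literature.AlgebraicGeometry.HodgeTheory

end
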